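import Literature.MathematicalPhysics.QuantumManyBody.BoseGasHardSet
import HarnessLib

/-!
# Coordinate lines through a relative position: the crossing geometry

Topic `Literature/MathematicalPhysics/QuantumManyBody`, sequel of `BoseGasHardSet.lean`. Elementary geometry of the
radius `ρ(τ) = |y + τ e_k|` along a coordinate line through a relative position `y ∈ ℝ³` (used line-wise in the
form-core theorem for hard-core pair potentials, where a finite-energy wave function must be compared with its value
at the nearest crossing of a hard sphere):

* `norm_add_smul_single_sq` — `|y + τ e_k|² = (|y|² - y_k²) + (y_k + τ)²`; `exists_norm_sq_le_three_mul_sq` — some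
  coordinate carries a third of `|y|²`;
* `strictMonoOn_norm_add_smul_single` / `strictAntiOn_norm_add_smul_single` — `ρ` is strictly monotone on either side
  of `τ = -y_k`; `hasDerivAt_norm_add_smul_single`, `abs_deriv_norm_add_smul_single_le_one` — `ρ' = (y_k+τ)/ρ`, `|ρ'| ≤ 1`;
* `exists_crossing_param` — **the crossing lemma**: if `|y| ≥ 40 s`, `|y|² ≤ 3 y_k²` and `|b - |y|| ≤ 3s`, the line
  reaches radius `b` at a parameter `|τ_b| < 11 s`, and `ρ` is strictly monotone on `[-11s, 11s]`
  (`strictMonoOn_or_strictAntiOn_of_crossing`).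

Tagged folklore.
-/

noncomputable section

open Set Metric

namespace Literature.MathematicalPhysics.QuantumManyBody.BoseGas

/-- `|y + τ e_k|² = (|y|² - y_k²) + (y_k + τ)²`. [folklore] -/
theorem norm_add_smul_single_sq (y : Space) (k : Fin 3) (τ : ℝ) :
    ‖y + τ • EuclideanSpace.single k (1 : ℝ)‖ ^ 2 = (‖y‖ ^ 2 - (y k) ^ 2) + (y k + τ) ^ 2 := by
  rw [EuclideanSpace.norm_sq_eq, EuclideanSpace.norm_sq_eq]
  simp only [Real.norm_eq_abs, sq_abs, Fin.sum_univ_three, PiLp.add_apply, PiLp.smul_apply,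
    PiLp.single_apply, smul_eq_mul, mul_ite, mul_one, mul_zero]
  fin_cases k <;> simp <;> ring

/-- `y_k² ≤ |y|²`. [folklore] -/
theorem sq_apply_le_norm_sq (y : Space) (k : Fin 3) : (y k) ^ 2 ≤ ‖y‖ ^ 2 := by
  have h := norm_add_smul_single_sq y k 0
  rw [zero_smul, add_zero, add_zero] at h
  nlinarith [sq_nonneg ‖y + (0 : ℝ) • EuclideanSpace.single k (1 : ℝ)‖, norm_add_smul_single_sq y k (-(y k)),
    sq_nonneg ‖y + (-(y k)) • EuclideanSpace.single k (1 : ℝ)‖]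

/-- Some coordinate carries a third of the squared norm: `∃ k, |y|² ≤ 3 y_k²`. [folklore] -/
theorem exists_norm_sq_le_three_mul_sq (y : Space) : ∃ k : Fin 3, ‖y‖ ^ 2 ≤ 3 * (y k) ^ 2 := by
  by_contra h
  push Not at h
  have hsum : ‖y‖ ^ 2 = ∑ k : Fin 3, (y k) ^ 2 := by
    rw [EuclideanSpace.norm_sq_eq]
    simp only [Real.norm_eq_abs, sq_abs]
  rw [Fin.sum_univ_three] at hsum
  linarith [h 0, h 1, h 2]

/-- `ρ(τ) = |y + τ e_k|` is strictly increasing on `[-y_k, ∞)`. [folklore] -/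
theorem strictMonoOn_norm_add_smul_single (y : Space) (k : Fin 3) :
    StrictMonoOn (fun τ : ℝ => ‖y + τ • EuclideanSpace.single k (1 : ℝ)‖) (Ici (-(y k))) := by
  intro a ha b hb hab
  have ha' : 0 ≤ y k + a := by rw [mem_Ici] at ha; linarith
  have h2 : (y k + a) ^ 2 < (y k + b) ^ 2 := by nlinarith
  have hsq : ‖y + a • EuclideanSpace.single k (1 : ℝ)‖ ^ 2 < ‖y + b • EuclideanSpace.single k (1 : ℝ)‖ ^ 2 := by
    rw [norm_add_smul_single_sq, norm_add_smul_single_sq]; linarith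
  exact lt_of_pow_lt_pow_left₀ 2 (norm_nonneg _) hsq

/-- `ρ(τ) = |y + τ e_k|` is strictly decreasing on `(-∞, -y_k]`. [folklore] -/
theorem strictAntiOn_norm_add_smul_single (y : Space) (k : Fin 3) :
    StrictAntiOn (fun τ : ℝ => ‖y + τ • EuclideanSpace.single k (1 : ℝ)‖) (Iic (-(y k))) := by
  intro a ha b hb hab
  have hb' : y k + b ≤ 0 := by rw [mem_Iic] at hb; linarith
  have h2 : (y k + b) ^ 2 < (y k + a) ^ 2 := by nlinarith
  have hsq : ‖y + b • EuclideanSpace.single k (1 : ℝ)‖ ^ 2 < ‖y + a • EuclideanSpace.single k (1 : ℝ)‖ ^ 2 := by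
    rw [norm_add_smul_single_sq, norm_add_smul_single_sq]; linarith
  exact lt_of_pow_lt_pow_left₀ 2 (norm_nonneg _) hsq

/-- `|y_k + τ| ≤ |y + τ e_k|`. [folklore] -/
theorem abs_add_le_norm_add_smul_single (y : Space) (k : Fin 3) (τ : ℝ) :
    |y k + τ| ≤ ‖y + τ • EuclideanSpace.single k (1 : ℝ)‖ := by
  exact abs_le_of_sq_le_sq (by rw [norm_add_smul_single_sq]; linarith [sq_apply_le_norm_sq y k]) (norm_nonneg _)

/-- The derivative of `ρ(τ) = |y + τ e_k|` away from the origin: `ρ' = (y_k + τ)/ρ`. [folklore] -/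
theorem hasDerivAt_norm_add_smul_single (y : Space) (k : Fin 3) {τ : ℝ}
    (h : ‖y + τ • EuclideanSpace.single k (1 : ℝ)‖ ≠ 0) :
    HasDerivAt (fun τ : ℝ => ‖y + τ • EuclideanSpace.single k (1 : ℝ)‖)
      ((y k + τ) / ‖y + τ • EuclideanSpace.single k (1 : ℝ)‖) τ := by
  have hfun : (fun τ : ℝ => ‖y + τ • EuclideanSpace.single k (1 : ℝ)‖) =
      fun τ => Real.sqrt ((‖y‖ ^ 2 - (y k) ^ 2) + (y k + τ) ^ 2) := by
    funext σ
    rw [← norm_add_smul_single_sq, Real.sqrt_sq (norm_nonneg _)]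
  have hinner : HasDerivAt (fun τ : ℝ => (‖y‖ ^ 2 - (y k) ^ 2) + (y k + τ) ^ 2) (2 * (y k + τ)) τ := by
    simpa using (((hasDerivAt_id τ).const_add (y k)).pow 2).const_add (‖y‖ ^ 2 - (y k) ^ 2)
  have hne : (‖y‖ ^ 2 - (y k) ^ 2) + (y k + τ) ^ 2 ≠ 0 := by
    rw [← norm_add_smul_single_sq]; exact pow_ne_zero 2 h
  rw [hfun]
  convert hinner.sqrt hne using 1
  rw [← norm_add_smul_single_sq, Real.sqrt_sq (norm_nonneg _)]
  field_simp

/-- `|ρ'| ≤ 1` for `ρ(τ) = |y + τ e_k|`. [folklore] -/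
theorem abs_deriv_norm_add_smul_single_le_one (y : Space) (k : Fin 3) (τ : ℝ) :
    |(y k + τ) / ‖y + τ • EuclideanSpace.single k (1 : ℝ)‖| ≤ 1 := by
  rcases eq_or_ne ‖y + τ • EuclideanSpace.single k (1 : ℝ)‖ 0 with h0 | h0
  · rw [h0, div_zero, abs_zero]; exact zero_le_one
  rw [abs_div, abs_of_nonneg (norm_nonneg _), div_le_one ((norm_nonneg _).lt_of_ne' h0)]
  exact abs_add_le_norm_add_smul_single y k τ

/-- Under `|y| ≥ 40 s`, `|y|² ≤ 3 y_k²` (`s > 0`): `23 s < |y_k|`. [folklore] -/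
theorem lt_abs_apply_of_crossing {y : Space} {k : Fin 3} {s : ℝ} (hs : 0 < s) (hD : 40 * s ≤ ‖y‖)
    (hk : ‖y‖ ^ 2 ≤ 3 * (y k) ^ 2) : 23 * s < |y k| := by
  have h1 : (23 * s) ^ 2 < |y k| ^ 2 := by rw [sq_abs]; nlinarith
  exact lt_of_pow_lt_pow_left₀ 2 (abs_nonneg _) h1

/-- The arithmetic of the crossing lemma: with `D² = c + p²`, `c ≥ 0`, `0 < s`, `40 s ≤ D`, `D < 2p`, `23 s < p`:
`(D + 3s)² < c + (p + 11s)²` and `c + (p - 11s)² < (D - 3s)²`. [folklore] -/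
theorem crossing_arith {c p D s : ℝ} (hDdef : D ^ 2 = c + p ^ 2) (hs : 0 < s) (hD : 40 * s ≤ D)
    (hp : D < 2 * p) (hp' : 23 * s < p) :
    (D + 3 * s) ^ 2 < c + (p + 11 * s) ^ 2 ∧ c + (p - 11 * s) ^ 2 < (D - 3 * s) ^ 2 := by
  constructor <;> nlinarith [mul_pos hs (by linarith : 0 < 22 * p - 6 * D)]

/-- `ρ = |y + · e_k|` is strictly monotone (increasing or decreasing) on `[-11s, 11s]` under the crossing hypotheses.
[folklore] -/
theorem strictMonoOn_or_strictAntiOn_of_crossing {y : Space} {k : Fin 3} {s : ℝ} (hs : 0 < s)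
    (hD : 40 * s ≤ ‖y‖) (hk : ‖y‖ ^ 2 ≤ 3 * (y k) ^ 2) :
    StrictMonoOn (fun τ : ℝ => ‖y + τ • EuclideanSpace.single k (1 : ℝ)‖) (Icc (-(11 * s)) (11 * s)) ∨
      StrictAntiOn (fun τ : ℝ => ‖y + τ • EuclideanSpace.single k (1 : ℝ)‖) (Icc (-(11 * s)) (11 * s)) := by
  have hyk := lt_abs_apply_of_crossing hs hD hk
  rcases lt_or_gt_of_ne (show y k ≠ 0 from fun h => by rw [h, abs_zero] at hyk; linarith) with hneg | hpos
  · right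
    rw [abs_of_neg hneg] at hyk
    exact (strictAntiOn_norm_add_smul_single y k).mono fun τ hτ => by
      rw [mem_Iic]; rw [mem_Icc] at hτ; linarith
  · left
    rw [abs_of_pos hpos] at hyk
    exact (strictMonoOn_norm_add_smul_single y k).mono fun τ hτ => by
      rw [mem_Ici]; rw [mem_Icc] at hτ; linarith

/-- On `[-11s, 11s]` the line stays away from the origin under the crossing hypotheses. [folklore] -/
theorem norm_add_smul_single_pos_of_crossing {y : Space} {k : Fin 3} {s : ℝ} (hs : 0 < s)
    (hD : 40 * s ≤ ‖y‖) (hk : ‖y‖ ^ 2 ≤ 3 * (y k) ^ 2) {τ : ℝ} (hτ : |τ| ≤ 11 * s) :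
    0 < ‖y + τ • EuclideanSpace.single k (1 : ℝ)‖ := by
  have hyk := lt_abs_apply_of_crossing hs hD hk
  have h1 : 0 < |y k + τ| := by
    rw [abs_pos]
    intro h0
    have h2 : |y k| = |τ| := by rw [show y k = -τ by linarith, abs_neg]
    linarith
  exact h1.trans_le (abs_add_le_norm_add_smul_single y k τ)

/-- **The crossing lemma.** If `|y| ≥ 40 s` (`s > 0`), `|y|² ≤ 3 y_k²` and `|b - |y|| ≤ 3 s`, the coordinate line
`τ ↦ y + τ e_k` reaches radius `b` at a parameter `τ_b ∈ (-11s, 11s)`. [folklore] -/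
theorem exists_crossing_param {y : Space} {k : Fin 3} {s b : ℝ} (hs : 0 < s) (hD : 40 * s ≤ ‖y‖)
    (hk : ‖y‖ ^ 2 ≤ 3 * (y k) ^ 2) (hb : |b - ‖y‖| ≤ 3 * s) :
    ∃ τ₀ ∈ Ioo (-(11 * s)) (11 * s), ‖y + τ₀ • EuclideanSpace.single k (1 : ℝ)‖ = b := by
  set ρ : ℝ → ℝ := fun τ => ‖y + τ • EuclideanSpace.single k (1 : ℝ)‖ with hρ
  have hcont : Continuous ρ := by
    rw [hρ]; fun_prop
  have hyk := lt_abs_apply_of_crossing hs hD hk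
  have hDlt : ‖y‖ < 2 * |y k| := by
    have h1 : ‖y‖ ^ 2 < (2 * |y k|) ^ 2 := by rw [mul_pow, sq_abs]; nlinarith
    exact lt_of_pow_lt_pow_left₀ 2 (by positivity) h1
  have hb1 : ‖y‖ - 3 * s ≤ b := by linarith [(abs_le.1 hb).1]
  have hb2 : b ≤ ‖y‖ + 3 * s := by linarith [(abs_le.1 hb).2]
  have hD3 : 0 ≤ ‖y‖ - 3 * s := by linarith
  have h11 : -(11 * s) ≤ 11 * s := by linarith
  rcases lt_or_gt_of_ne (show y k ≠ 0 from fun h => by rw [h, abs_zero] at hyk; linarith) with hneg | hpos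
  · -- `y_k < 0`: decreasing; use `p = -y_k`
    rw [abs_of_neg hneg] at hyk hDlt
    obtain ⟨hA, hB⟩ := crossing_arith (c := ‖y‖ ^ 2 - (y k) ^ 2) (p := -(y k)) (by ring) hs hD hDlt hyk
    have hupper : ‖y‖ + 3 * s < ρ (-(11 * s)) := by
      refine lt_of_pow_lt_pow_left₀ 2 (norm_nonneg _) ?_
      simp only [hρ]; rw [norm_add_smul_single_sq]
      linarith [hA, show (-y k + 11 * s) ^ 2 = (y k + -(11 * s)) ^ 2 by ring]
    have hlower : ρ (11 * s) < ‖y‖ - 3 * s := by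
      refine lt_of_pow_lt_pow_left₀ 2 hD3 ?_
      simp only [hρ]; rw [norm_add_smul_single_sq]
      linarith [hB, show (-y k - 11 * s) ^ 2 = (y k + 11 * s) ^ 2 by ring]
    have hmem : b ∈ Ioo (ρ (11 * s)) (ρ (-(11 * s))) := ⟨by linarith, by linarith⟩
    obtain ⟨τ₀, hτ₀, hρτ₀⟩ := intermediate_value_Ioo' h11 hcont.continuousOn hmem
    exact ⟨τ₀, hτ₀, hρτ₀⟩
  · rw [abs_of_pos hpos] at hyk hDlt
    obtain ⟨hA, hB⟩ := crossing_arith (c := ‖y‖ ^ 2 - (y k) ^ 2) (p := y k) (by ring) hs hD hDlt hyk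
    have hupper : ‖y‖ + 3 * s < ρ (11 * s) := by
      refine lt_of_pow_lt_pow_left₀ 2 (norm_nonneg _) ?_
      simp only [hρ]; rw [norm_add_smul_single_sq]; exact hA
    have hlower : ρ (-(11 * s)) < ‖y‖ - 3 * s := by
      refine lt_of_pow_lt_pow_left₀ 2 hD3 ?_
      simp only [hρ]; rw [norm_add_smul_single_sq]
      linarith [hB, show (y k - 11 * s) ^ 2 = (y k + -(11 * s)) ^ 2 by ring]
    have hmem : b ∈ Ioo (ρ (-(11 * s))) (ρ (11 * s)) := ⟨by linarith, by linarith⟩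
    obtain ⟨τ₀, hτ₀, hρτ₀⟩ := intermediate_value_Ioo h11 hcont.continuousOn hmem
    exact ⟨τ₀, hτ₀, hρτ₀⟩

end Literature.MathematicalPhysics.QuantumManyBody.BoseGas

end
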